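import Mathlib
import HarnessLib

/-!
# OutsiderSandwich — Segre lemmas: bilinear families of singular rank-one `3 × 3` matrices
(decomp-mm lens 4 «minimal-counterexample / extremal reduction», gen 42, kernel K42-a part 1;
THESES-FREE, DEFINITION-FREE, pure linear algebra over `ℂ`)

The linear algebra behind the SEGRE TRANSPORT of `OutsiderSandwichSegreTransport`: a restriction
`2·⟨2,2,2⟩ ≤ D^{⊠2}` carries, block by block, the rank-one cone `{u vᵀ} ⊂ ℂ^{2×2}` of a `⟨2,2,2⟩`
summand LINEARLY and INJECTIVELY into the minimal slice layer of `D^{⊠2}`, whose members are the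
products `λ ⊗ μ` with `D(λ)`, `D(μ)` singular, i.e. with a vanishing coordinate each (slice gap).
On `3 × 3` matrices (`λ ⊗ μ = vecMulVec λ μ`) such a transport is a linearly independent family
`G : Fin 2 × Fin 2 → ℂ^{3×3}` all of whose bilinear rank-one combinations `∑ uᵢ vⱼ G (i,j)`
(`u, v ≠ 0`) are `vecMulVec x y` with `x`, `y` each having a zero coordinate.  **The cross lemma
`cross_of_bilinear_rank_one`**: then some cross `{a} × Fin 3 ∪ Fin 3 × {b}` carries no entry of any
`G (i,j)` — the family spans the `4`-space `P_a ⊗ P_b`.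

Ingredients ([folklore], [cite: HornJohnson2013, §0.4]): uniqueness of rank-one factors, "a sum of
two rank-one matrices with independent left AND right factors is not rank-one" (a `2 × 2` minor is a
product of minors), a pencil all of whose members have a vanishing coordinate has a common one
(pigeonhole on four members), the pencil dichotomy `pencil`, and two dependence tests.  The cross
lemma is the `16`-case analysis of the four coordinate pencils (two columns, two rows): the two
"opposite" colourings give the cross, the other fourteen contradict independence.

References: [cite: HornJohnson2013, §0.4]; [cite: CoppersmithWinograd1990, §6];
[cite: BurgisserClausenShokrollahi1997, (15.25)]; R. Westwick, *Transformations on tensor spaces*,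
Pacific J. Math. 23 (1967) 613–620 (linear rank-one preservers — the classical frame; not used).
-/

set_option linter.dupNamespace false

namespace Summit.MatrixMultiplication.MatrixMultiplication.Theorems.OutsiderSandwichSegreLemmas

open Matrix
open scoped BigOperators

/-! ## §1  Rank-one factors -/

/-- **Uniqueness of rank-one factors**: `x ⊗ y = x' ⊗ y'` with `x i₀ ≠ 0 ≠ y j₀` makes `x ∥ x'` and
`y ∥ y'`. [cite: HornJohnson2013, §0.4] -/
theorem smul_of_vecMulVec_eq {m n : Type*} {x x' : m → ℂ} {y y' : n → ℂ}
    (h : vecMulVec x y = vecMulVec x' y') {i₀ : m} {j₀ : n} (hx : x i₀ ≠ 0) (hy : y j₀ ≠ 0) :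
    (∃ c : ℂ, x = c • x') ∧ (∃ c : ℂ, y = c • y') := by
  have he : ∀ i j, x i * y j = x' i * y' j := fun i j => by
    simpa [vecMulVec_apply] using congr_fun (congr_fun h i) j
  have hxy : x' i₀ * y' j₀ ≠ 0 := he i₀ j₀ ▸ mul_ne_zero hx hy
  have hx' : x' i₀ ≠ 0 := left_ne_zero_of_mul hxy
  have hy' : y' j₀ ≠ 0 := right_ne_zero_of_mul hxy
  refine ⟨⟨y' j₀ / y j₀, funext fun i => ?_⟩, ⟨x' i₀ / x i₀, funext fun j => ?_⟩⟩
  · simp only [Pi.smul_apply, smul_eq_mul]; field_simp; linear_combination he i j₀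
  · simp only [Pi.smul_apply, smul_eq_mul]; field_simp; linear_combination he i₀ j

/-- Zero coordinates transfer along `x ⊗ y = x' ⊗ y' ≠ 0`. [cite: HornJohnson2013, §0.4] -/
theorem zero_coord_of_vecMulVec_eq {m n : Type*} {x x' : m → ℂ} {y y' : n → ℂ}
    (h : vecMulVec x y = vecMulVec x' y') (h0 : vecMulVec x y ≠ 0)
    (ha : ∃ a, x' a = 0) (hb : ∃ b, y' b = 0) : (∃ a, x a = 0) ∧ (∃ b, y b = 0) := by
  have hx : x ≠ 0 := fun hx => h0 (by ext i j; simp [vecMulVec_apply, hx])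
  have hy : y ≠ 0 := fun hy => h0 (by ext i j; simp [vecMulVec_apply, hy])
  obtain ⟨i₀, hi₀⟩ := Function.ne_iff.mp hx
  obtain ⟨j₀, hj₀⟩ := Function.ne_iff.mp hy
  replace hi₀ : x i₀ ≠ 0 := hi₀
  replace hj₀ : y j₀ ≠ 0 := hj₀
  obtain ⟨⟨c, hc⟩, ⟨d, hd⟩⟩ := smul_of_vecMulVec_eq h hi₀ hj₀
  obtain ⟨a, ha⟩ := ha
  obtain ⟨b, hb⟩ := hb
  exact ⟨⟨a, by simp [hc, ha]⟩, ⟨b, by simp [hd, hb]⟩⟩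

/-- **Two rank-one terms**: if `x₁ ⊗ y₁ + x₂ ⊗ y₂` is rank-one (`= λ ⊗ μ`) and `x₁, y₁ ≠ 0`, then
`x₂ ∥ x₁` or `y₂ ∥ y₁` — otherwise a `2 × 2` minor equals a product of two non-zero minors.
[cite: HornJohnson2013, §0.4] -/
theorem parallel_of_add_eq_vecMulVec {m n : Type*} {x₁ x₂ lam : m → ℂ} {y₁ y₂ mu : n → ℂ}
    (h : vecMulVec x₁ y₁ + vecMulVec x₂ y₂ = vecMulVec lam mu) (hx : x₁ ≠ 0) (hy : y₁ ≠ 0) :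
    (∃ c : ℂ, x₂ = c • x₁) ∨ (∃ c : ℂ, y₂ = c • y₁) := by
  by_contra hcon; push Not at hcon; obtain ⟨hX, hY⟩ := hcon
  obtain ⟨i₀, hi₀⟩ := Function.ne_iff.mp hx
  obtain ⟨j₀, hj₀⟩ := Function.ne_iff.mp hy
  replace hi₀ : x₁ i₀ ≠ 0 := hi₀
  replace hj₀ : y₁ j₀ ≠ 0 := hj₀
  have he : ∀ i j, x₁ i * y₁ j + x₂ i * y₂ j = lam i * mu j := fun i j => by
    simpa [vecMulVec_apply, Matrix.add_apply] using congr_fun (congr_fun h i) j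
  -- a non-zero `x`-minor
  obtain ⟨i₁, hi₁⟩ : ∃ i₁, x₁ i₀ * x₂ i₁ - x₁ i₁ * x₂ i₀ ≠ 0 := by
    by_contra hm; push Not at hm
    refine hX (x₂ i₀ / x₁ i₀) (funext fun i => ?_)
    simp only [Pi.smul_apply, smul_eq_mul]; field_simp; linear_combination hm i
  obtain ⟨j₁, hj₁⟩ : ∃ j₁, y₁ j₀ * y₂ j₁ - y₁ j₁ * y₂ j₀ ≠ 0 := by
    by_contra hm; push Not at hm
    refine hY (y₂ j₀ / y₁ j₀) (funext fun j => ?_)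
    simp only [Pi.smul_apply, smul_eq_mul]; field_simp; linear_combination hm j
  have key : (x₁ i₀ * y₁ j₀ + x₂ i₀ * y₂ j₀) * (x₁ i₁ * y₁ j₁ + x₂ i₁ * y₂ j₁) -
      (x₁ i₀ * y₁ j₁ + x₂ i₀ * y₂ j₁) * (x₁ i₁ * y₁ j₀ + x₂ i₁ * y₂ j₀) = 0 := by
    rw [he, he, he, he]; ring
  have : (x₁ i₀ * x₂ i₁ - x₁ i₁ * x₂ i₀) * (y₁ j₀ * y₂ j₁ - y₁ j₁ * y₂ j₀) = 0 := by
    linear_combination key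
  exact mul_ne_zero hi₁ hj₁ this

/-- **Common zero of a pencil**: if every non-trivial combination `s y₁ + t y₂` of two vectors in
`ℂ³` has a vanishing coordinate, then `y₁` and `y₂` vanish at a common coordinate (four members
`y₁ + t y₂`, `t = 0,1,2,3`, three coordinates: pigeonhole). [folklore] -/
theorem common_zero {y₁ y₂ : Fin 3 → ℂ}
    (h : ∀ s t : ℂ, (s ≠ 0 ∨ t ≠ 0) → ∃ b, s * y₁ b + t * y₂ b = 0) :
    ∃ b, y₁ b = 0 ∧ y₂ b = 0 := by
  by_contra hne
  push Not at hne
  choose b hb using fun t : ℂ => h 1 t (Or.inl one_ne_zero)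
  obtain ⟨k, k', hkk, hbk⟩ :=
    Fintype.exists_ne_map_eq_of_card_lt (fun k : Fin 4 => b (k : ℂ)) (by simp)
  have h1 := hb (k : ℂ); have h2 := hb (k' : ℂ); rw [hbk] at h1
  have ht : ((k : ℕ) : ℂ) ≠ ((k' : ℕ) : ℂ) := by norm_cast; exact fun e => hkk (Fin.ext e)
  have hy2 : y₂ (b (k' : ℂ)) = 0 := by
    have : (((k : ℕ) : ℂ) - ((k' : ℕ) : ℂ)) * y₂ (b (k' : ℂ)) = 0 := by linear_combination h1 - h2
    exact (mul_eq_zero.mp this).resolve_left (sub_ne_zero.mpr ht)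
  have hy1 : y₁ (b (k' : ℂ)) = 0 := by rw [hy2, mul_zero, add_zero, one_mul] at h2; exact h2
  exact hne _ hy1 hy2

/-! ## §2  The pencil dichotomy -/

/-- **Pencil dichotomy.**  Two independent rank-one matrices `M₁ = x₁ ⊗ y₁`, `M₂ = x₂ ⊗ y₂` all of
whose non-trivial combinations are rank-one WITH A VANISHING COORDINATE IN EACH FACTOR: either the
left factors are proportional and the right factors share a zero coordinate, or the other way round.
[cite: HornJohnson2013, §0.4] -/
theorem pencil {M₁ M₂ : Matrix (Fin 3) (Fin 3) ℂ} {x₁ y₁ x₂ y₂ : Fin 3 → ℂ}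
    (h₁ : M₁ = vecMulVec x₁ y₁) (h₂ : M₂ = vecMulVec x₂ y₂)
    (hind : ∀ s t : ℂ, s • M₁ + t • M₂ = 0 → s = 0 ∧ t = 0)
    (hSP : ∀ s t : ℂ, (s ≠ 0 ∨ t ≠ 0) → ∃ x y : Fin 3 → ℂ,
      (∃ a, x a = 0) ∧ (∃ b, y b = 0) ∧ s • M₁ + t • M₂ = vecMulVec x y) :
    (∃ c : ℂ, c ≠ 0 ∧ x₂ = c • x₁ ∧ ∃ b, y₁ b = 0 ∧ y₂ b = 0) ∨
      (∃ c : ℂ, c ≠ 0 ∧ y₂ = c • y₁ ∧ ∃ a, x₁ a = 0 ∧ x₂ a = 0) := by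
  have hM₁ : M₁ ≠ 0 := fun h0 => one_ne_zero (hind 1 0 (by simp [h0])).1
  have hM₂ : M₂ ≠ 0 := fun h0 => one_ne_zero (hind 0 1 (by simp [h0])).2
  have hx₁ : x₁ ≠ 0 := fun h0 => hM₁ (by simp [h₁, h0])
  have hy₁ : y₁ ≠ 0 := fun h0 => hM₁ (by simp [h₁, h0])
  have hx₂ : x₂ ≠ 0 := fun h0 => hM₂ (by simp [h₂, h0])
  have hy₂ : y₂ ≠ 0 := fun h0 => hM₂ (by simp [h₂, h0])
  obtain ⟨lam, mu, -, -, h11⟩ := hSP 1 1 (Or.inl one_ne_zero)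
  rw [one_smul, one_smul, h₁, h₂] at h11
  rcases parallel_of_add_eq_vecMulVec h11 hx₁ hy₁ with ⟨c, hc⟩ | ⟨c, hc⟩
  · -- left factors proportional: the right pencil `s y₁ + (t c) y₂` has singular members
    have hc0 : c ≠ 0 := by rintro rfl; exact hx₂ (by simp [hc])
    refine Or.inl ⟨c, hc0, hc, ?_⟩
    have key : ∀ s t : ℂ, (s ≠ 0 ∨ t ≠ 0) → ∃ b, s * y₁ b + t * (c • y₂) b = 0 := by
      intro s t hst
      obtain ⟨x, y, ha, hb, hst'⟩ := hSP s t hst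
      have hcomb : s • M₁ + t • M₂ = vecMulVec x₁ (s • y₁ + t • (c • y₂)) := by
        rw [h₁, h₂, hc, vecMulVec_add, vecMulVec_smul, vecMulVec_smul, vecMulVec_smul,
          smul_vecMulVec]
      have hne : vecMulVec x₁ (s • y₁ + t • (c • y₂)) ≠ 0 := by
        rw [← hcomb]; intro h0; obtain ⟨rfl, rfl⟩ := hind s t h0; simp at hst
      obtain ⟨-, ⟨b, hb'⟩⟩ := zero_coord_of_vecMulVec_eq (hcomb.symm.trans hst') hne ha hb
      exact ⟨b, by simpa using hb'⟩
    obtain ⟨b, hb1, hb2⟩ := common_zero key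
    exact ⟨b, hb1, by simpa [hc0] using hb2⟩
  · have hc0 : c ≠ 0 := by rintro rfl; exact hy₂ (by simp [hc])
    refine Or.inr ⟨c, hc0, hc, ?_⟩
    have key : ∀ s t : ℂ, (s ≠ 0 ∨ t ≠ 0) → ∃ a, s * x₁ a + t * (c • x₂) a = 0 := by
      intro s t hst
      obtain ⟨x, y, ha, hb, hst'⟩ := hSP s t hst
      have hcomb : s • M₁ + t • M₂ = vecMulVec (s • x₁ + t • (c • x₂)) y₁ := by
        rw [h₁, h₂, hc, add_vecMulVec, smul_vecMulVec, smul_vecMulVec, smul_vecMulVec,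
          vecMulVec_smul]
      have hne : vecMulVec (s • x₁ + t • (c • x₂)) y₁ ≠ 0 := by
        rw [← hcomb]; intro h0; obtain ⟨rfl, rfl⟩ := hind s t h0; simp at hst
      obtain ⟨⟨a, ha'⟩, -⟩ := zero_coord_of_vecMulVec_eq (hcomb.symm.trans hst') hne ha hb
      exact ⟨a, by simpa using ha'⟩
    obtain ⟨a, ha1, ha2⟩ := common_zero key
    exact ⟨a, ha1, by simpa [hc0] using ha2⟩

/-! ## §3  Dependence tests -/

/-- Rank-one matrices with a COMMON left factor span at most `3` dimensions. [folklore] -/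
theorem not_linearIndependent_of_left_parallel {ι : Type*} [Fintype ι]
    {G : ι → Matrix (Fin 3) (Fin 3) ℂ} {x y : ι → Fin 3 → ℂ} (x₀ : Fin 3 → ℂ)
    (hG : ∀ p, G p = vecMulVec (x p) (y p)) (hk : ∀ p, ∃ k : ℂ, x p = k • x₀)
    (hcard : 3 < Fintype.card ι) : ¬ LinearIndependent ℂ G := by
  intro hli
  choose k hk using hk
  let φ : (Fin 3 → ℂ) →ₗ[ℂ] Matrix (Fin 3) (Fin 3) ℂ :=
    { toFun := fun z => vecMulVec x₀ z
      map_add' := fun z z' => vecMulVec_add x₀ z z'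
      map_smul' := fun c z => vecMulVec_smul c x₀ z }
  have hcomp : G = φ ∘ fun p => k p • y p := by
    funext p
    simp only [Function.comp_apply, φ, LinearMap.coe_mk, AddHom.coe_mk, hG p, hk p,
      smul_vecMulVec, vecMulVec_smul]
  rw [hcomp] at hli
  have h := (LinearIndependent.of_comp φ hli).fintype_card_le_finrank
  simp at h
  omega

/-- Rank-one matrices with a COMMON right factor span at most `3` dimensions. [folklore] -/
theorem not_linearIndependent_of_right_parallel {ι : Type*} [Fintype ι]
    {G : ι → Matrix (Fin 3) (Fin 3) ℂ} {x y : ι → Fin 3 → ℂ} (y₀ : Fin 3 → ℂ)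
    (hG : ∀ p, G p = vecMulVec (x p) (y p)) (hk : ∀ p, ∃ k : ℂ, y p = k • y₀)
    (hcard : 3 < Fintype.card ι) : ¬ LinearIndependent ℂ G := by
  intro hli
  choose k hk using hk
  let φ : (Fin 3 → ℂ) →ₗ[ℂ] Matrix (Fin 3) (Fin 3) ℂ :=
    { toFun := fun z => vecMulVec z y₀
      map_add' := fun z z' => add_vecMulVec z z' y₀
      map_smul' := fun c z => smul_vecMulVec c z y₀ }
  have hcomp : G = φ ∘ fun p => k p • x p := by
    funext p
    simp only [Function.comp_apply, φ, LinearMap.coe_mk, AddHom.coe_mk, hG p, hk p,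
      smul_vecMulVec, vecMulVec_smul]
  rw [hcomp] at hli
  have h := (LinearIndependent.of_comp φ hli).fintype_card_le_finrank
  simp at h
  omega

/-- A relation `a • G p = b • G q` (`p ≠ q`, `b ≠ 0`) defeats independence. [folklore] -/
theorem not_linearIndependent_of_rel {ι V : Type*} [Fintype ι] [DecidableEq ι] [AddCommGroup V]
    [Module ℂ V] {G : ι → V} {p q : ι} {a b : ℂ} (hpq : p ≠ q) (hb : b ≠ 0)
    (h : a • G p = b • G q) : ¬ LinearIndependent ℂ G := by
  intro hli
  have hg := Fintype.linearIndependent_iff.mp hli (Pi.single p a - Pi.single q b) ?_ q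
  · simp [hpq] at hg; exact hb hg
  · simp only [Pi.sub_apply, sub_smul, Finset.sum_sub_distrib]
    rw [Finset.sum_eq_single p (fun r _ hr => by simp [hr]) (by simp),
      Finset.sum_eq_single q (fun r _ hr => by simp [hr]) (by simp)]
    simp [h]

/-! ## §4  The cross lemma -/

/-- **The cross lemma.**  A linearly independent family `G : Fin 2 × Fin 2 → ℂ^{3×3}` all of whose
bilinear rank-one combinations `∑ uᵢ vⱼ G (i,j)` (`u, v ≠ 0`) are rank-one with a vanishing
coordinate in each factor is supported off a common cross: `G p i j = 0` whenever `i = a` or `j = b`.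
(Sixteen-case analysis of the two column pencils and the two row pencils via `pencil`; the two
"opposite" colourings give the cross, the other fourteen contradict independence.)
[cite: HornJohnson2013, §0.4]; [cite: CoppersmithWinograd1990, §6] -/
theorem cross_of_bilinear_rank_one {G : Fin 2 × Fin 2 → Matrix (Fin 3) (Fin 3) ℂ}
    (hind : LinearIndependent ℂ G)
    (hSP : ∀ u v : Fin 2 → ℂ, u ≠ 0 → v ≠ 0 → ∃ x y : Fin 3 → ℂ,
      (∃ a, x a = 0) ∧ (∃ b, y b = 0) ∧ ∑ p, (u p.1 * v p.2) • G p = vecMulVec x y) :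
    ∃ a b : Fin 3, ∀ p i j, (i = a ∨ j = b) → G p i j = 0 := by
  classical
  -- coordinate members of the family are singular rank-one
  have hsingle : ∀ p : Fin 2 × Fin 2,
      ∑ q, ((Pi.single p.1 (1 : ℂ) : Fin 2 → ℂ) q.1 * (Pi.single p.2 (1 : ℂ) : Fin 2 → ℂ) q.2) •
        G q = G p := by
    intro p
    rw [Finset.sum_eq_single p _ (by simp)]
    · simp
    · rintro q - hq
      have : q.1 ≠ p.1 ∨ q.2 ≠ p.2 := by
        by_contra h; push Not at h; exact hq (Prod.ext h.1 h.2)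
      rcases this with h | h
      · simp [Pi.single_apply, h]
      · simp [Pi.single_apply, h]
  have hne1 : ∀ i : Fin 2, (Pi.single i (1 : ℂ) : Fin 2 → ℂ) ≠ 0 := fun i h => by
    simpa using congr_fun h i
  have hfac : ∀ p, ∃ x y : Fin 3 → ℂ, (∃ a, x a = 0) ∧ (∃ b, y b = 0) ∧ G p = vecMulVec x y := by
    intro p
    obtain ⟨x, y, ha, hb, h⟩ := hSP _ _ (hne1 p.1) (hne1 p.2)
    exact ⟨x, y, ha, hb, by rw [← hsingle p]; exact h⟩
  choose x y hxa hyb hG using hfac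
  -- the column pencils `u = (s,t), v = e_j` and the row pencils `u = e_i, v = (s,t)`
  have hvne : ∀ s t : ℂ, (s ≠ 0 ∨ t ≠ 0) → (![s, t] : Fin 2 → ℂ) ≠ 0 := by
    intro s t hst h
    have h0 := congr_fun h 0; have h1 := congr_fun h 1
    simp only [cons_val_zero, cons_val_one, Pi.zero_apply] at h0 h1
    exact hst.elim (fun hs => hs h0) (fun ht => ht h1)
  have hSPcol : ∀ (j : Fin 2) (s t : ℂ), (s ≠ 0 ∨ t ≠ 0) → ∃ x' y' : Fin 3 → ℂ,
      (∃ a, x' a = 0) ∧ (∃ b, y' b = 0) ∧ s • G (0, j) + t • G (1, j) = vecMulVec x' y' := by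
    intro j s t hst
    obtain ⟨x', y', ha, hb, h⟩ := hSP _ _ (hvne s t hst) (hne1 j)
    refine ⟨x', y', ha, hb, ?_⟩
    rw [← h]
    fin_cases j <;> simp [Fintype.sum_prod_type, Fin.sum_univ_two]
  have hSProw : ∀ (i : Fin 2) (s t : ℂ), (s ≠ 0 ∨ t ≠ 0) → ∃ x' y' : Fin 3 → ℂ,
      (∃ a, x' a = 0) ∧ (∃ b, y' b = 0) ∧ s • G (i, 0) + t • G (i, 1) = vecMulVec x' y' := by
    intro i s t hst
    obtain ⟨x', y', ha, hb, h⟩ := hSP _ _ (hne1 i) (hvne s t hst)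
    refine ⟨x', y', ha, hb, ?_⟩
    rw [← h]
    fin_cases i <;> simp [Fintype.sum_prod_type, Fin.sum_univ_two]
  have hpair : ∀ p q : Fin 2 × Fin 2, p ≠ q → ∀ s t : ℂ, s • G p + t • G q = 0 →
      s = 0 ∧ t = 0 := by
    intro p q hpq s t h
    have hg := Fintype.linearIndependent_iff.mp hind (Pi.single p s + Pi.single q t) ?_
    · exact ⟨by simpa [hpq] using hg p, by simpa [hpq.symm] using hg q⟩
    · simp only [Pi.add_apply, add_smul, Finset.sum_add_distrib]
      rw [Finset.sum_eq_single p (fun r _ hr => by simp [hr]) (by simp),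
        Finset.sum_eq_single q (fun r _ hr => by simp [hr]) (by simp)]
      simpa using h
  have h4 : 3 < Fintype.card (Fin 2 × Fin 2) := by simp
  -- dependence tests specialised to the family
  have killX : (∃ k : ℂ, x (1, 0) = k • x (0, 0)) → (∃ k : ℂ, x (0, 1) = k • x (0, 0)) →
      (∃ k : ℂ, x (1, 1) = k • x (0, 0)) → False := by
    intro h₁ h₂ h₃
    refine not_linearIndependent_of_left_parallel (x (0, 0)) hG ?_ h4 hind
    rintro ⟨i, j⟩
    fin_cases i <;> fin_cases j
    exacts [⟨1, by simp⟩, h₂, h₁, h₃]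
  have killY : (∃ k : ℂ, y (1, 0) = k • y (0, 0)) → (∃ k : ℂ, y (0, 1) = k • y (0, 0)) →
      (∃ k : ℂ, y (1, 1) = k • y (0, 0)) → False := by
    intro h₁ h₂ h₃
    refine not_linearIndependent_of_right_parallel (y (0, 0)) hG ?_ h4 hind
    rintro ⟨i, j⟩
    fin_cases i <;> fin_cases j
    exacts [⟨1, by simp⟩, h₂, h₁, h₃]
  have rel : ∀ (p q : Fin 2 × Fin 2) (a b : ℂ), p ≠ q → b ≠ 0 →
      (∀ i j, a * (x p i * y p j) = b * (x q i * y q j)) → False := by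
    intro p q a b hpq hb h
    refine not_linearIndependent_of_rel (a := a) hpq hb ?_ hind
    ext i j
    simp only [hG, Matrix.smul_apply, vecMulVec_apply, smul_eq_mul]
    exact h i j
  have good : ∀ a b : Fin 3, (∀ p, x p a = 0) → (∀ p, y p b = 0) →
      ∃ a b : Fin 3, ∀ p i j, (i = a ∨ j = b) → G p i j = 0 := by
    intro a b ha hb
    refine ⟨a, b, fun p i j hij => ?_⟩
    rw [hG p, vecMulVec_apply]
    rcases hij with rfl | rfl
    · simp [ha p]
    · simp [hb p]
  -- the four pencils
  have hc0 := pencil (hG (0, 0)) (hG (1, 0)) (hpair (0, 0) (1, 0) (by decide)) (hSPcol 0)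
  have hc1 := pencil (hG (0, 1)) (hG (1, 1)) (hpair (0, 1) (1, 1) (by decide)) (hSPcol 1)
  have hr0 := pencil (hG (0, 0)) (hG (0, 1)) (hpair (0, 0) (0, 1) (by decide)) (hSProw 0)
  have hr1 := pencil (hG (1, 0)) (hG (1, 1)) (hpair (1, 0) (1, 1) (by decide)) (hSProw 1)
  rcases hc0 with ⟨c₀, hc₀, hx10, b₀, hy00b, hy10b⟩ | ⟨d₀, hd₀, hy10, a₀, hx00a, hx10a⟩ <;>
  rcases hc1 with ⟨c₁, hc₁, hx11c, b₁, hy01b, hy11b⟩ | ⟨d₁, hd₁, hy11d, a₁, hx01a, hx11a⟩ <;>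
  rcases hr0 with ⟨e₀, he₀, hx01e, b₂, hy00b', hy01b'⟩ | ⟨f₀, hf₀, hy01f, a₂, hx00a', hx01a'⟩ <;>
  rcases hr1 with ⟨e₁, he₁, hx11e, b₃, hy10b'', hy11b''⟩ | ⟨f₁, hf₁, hy11f, a₃, hx10a'', hx11a''⟩
  · -- 1  X X X X : all left factors parallel
    exact (killX ⟨c₀, hx10⟩ ⟨e₀, hx01e⟩ ⟨c₁ * e₀, by rw [hx11c, hx01e, smul_smul]⟩).elim
  · -- 2  X X X Y
    exact (killX ⟨c₀, hx10⟩ ⟨e₀, hx01e⟩ ⟨c₁ * e₀, by rw [hx11c, hx01e, smul_smul]⟩).elim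
  · -- 3  X X Y X
    exact (killX ⟨c₀, hx10⟩ ⟨c₁⁻¹ * (e₁ * c₀), by
      rw [mul_smul, mul_smul, ← hx10, ← hx11e, hx11c, inv_smul_smul₀ hc₁]⟩
      ⟨e₁ * c₀, by rw [hx11e, hx10, smul_smul]⟩).elim
  · -- 4  X X Y Y : the cross (columns `x`-parallel, rows `y`-parallel)
    refine good a₂ b₀ ?_ ?_
    · rintro ⟨i, j⟩
      fin_cases i <;> fin_cases j
      exacts [hx00a', hx01a', by simp [hx10, hx00a'], by simp [hx11c, hx01a']]
    · rintro ⟨i, j⟩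
      fin_cases i <;> fin_cases j
      exacts [hy00b, by simp [hy01f, hy00b], hy10b, by simp [hy11f, hy10b]]
  · -- 5  X Y X X
    exact (killX ⟨c₀, hx10⟩ ⟨e₀, hx01e⟩ ⟨e₁ * c₀, by rw [hx11e, hx10, smul_smul]⟩).elim
  · -- 6  X Y X Y : `G (1,0) ∥ G (0,1)`
    have hyy : ∀ j, d₁ * y (0, 1) j = f₁ * y (1, 0) j := fun j => by
      have e1 := congr_fun hy11d j; have e2 := congr_fun hy11f j
      simp only [Pi.smul_apply, smul_eq_mul] at e1 e2; rw [← e1, ← e2]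
    refine (rel (1, 0) (0, 1) (e₀ * f₁) (c₀ * d₁) (by decide) (mul_ne_zero hc₀ hd₁) ?_).elim
    intro i j
    simp only [hx10, hx01e, Pi.smul_apply, smul_eq_mul]
    linear_combination (-(c₀ * e₀ * x (0, 0) i)) * hyy j
  · -- 7  X Y Y X : `G (0,0) ∥ G (1,1)`
    refine (rel (0, 0) (1, 1) (e₁ * c₀ * (d₁ * f₀)) 1 (by decide) one_ne_zero ?_).elim
    intro i j
    simp only [hx11e, hx10, hy11d, hy01f, Pi.smul_apply, smul_eq_mul]
    ring
  · -- 8  X Y Y Y : all right factors parallel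
    exact (killY ⟨f₁⁻¹ * (d₁ * f₀), by
      rw [mul_smul, mul_smul, ← hy01f, ← hy11d, hy11f, inv_smul_smul₀ hf₁]⟩
      ⟨f₀, hy01f⟩ ⟨d₁ * f₀, by rw [hy11d, hy01f, smul_smul]⟩).elim
  · -- 9  Y X X X
    exact (killX ⟨e₁⁻¹ * (c₁ * e₀), by
      rw [mul_smul, mul_smul, ← hx01e, ← hx11c, hx11e, inv_smul_smul₀ he₁]⟩
      ⟨e₀, hx01e⟩ ⟨c₁ * e₀, by rw [hx11c, hx01e, smul_smul]⟩).elim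
  · -- 10  Y X X Y : `G (0,0) ∥ G (1,1)`
    refine (rel (0, 0) (1, 1) (c₁ * e₀ * (f₁ * d₀)) 1 (by decide) one_ne_zero ?_).elim
    intro i j
    simp only [hx11c, hx01e, hy11f, hy10, Pi.smul_apply, smul_eq_mul]
    ring
  · -- 11  Y X Y X : `G (1,0) ∥ G (0,1)`
    have hxx : ∀ i, c₁ * x (0, 1) i = e₁ * x (1, 0) i := fun i => by
      have e1 := congr_fun hx11c i; have e2 := congr_fun hx11e i
      simp only [Pi.smul_apply, smul_eq_mul] at e1 e2; rw [← e1, ← e2]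
    refine (rel (1, 0) (0, 1) (e₁ * f₀) (c₁ * d₀) (by decide) (mul_ne_zero hc₁ hd₀) ?_).elim
    intro i j
    simp only [hy10, hy01f, Pi.smul_apply, smul_eq_mul]
    linear_combination (-(f₀ * d₀ * y (0, 0) j)) * hxx i
  · -- 12  Y X Y Y
    exact (killY ⟨d₀, hy10⟩ ⟨f₀, hy01f⟩ ⟨f₁ * d₀, by rw [hy11f, hy10, smul_smul]⟩).elim
  · -- 13  Y Y X X : the cross (columns `y`-parallel, rows `x`-parallel)
    refine good a₀ b₂ ?_ ?_
    · rintro ⟨i, j⟩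
      fin_cases i <;> fin_cases j
      exacts [hx00a, by simp [hx01e, hx00a], hx10a, by simp [hx11e, hx10a]]
    · rintro ⟨i, j⟩
      fin_cases i <;> fin_cases j
      exacts [hy00b', hy01b', by simp [hy10, hy00b'], by simp [hy11d, hy01b']]
  · -- 14  Y Y X Y
    exact (killY ⟨d₀, hy10⟩ ⟨d₁⁻¹ * (f₁ * d₀), by
      rw [mul_smul, mul_smul, ← hy10, ← hy11f, hy11d, inv_smul_smul₀ hd₁]⟩
      ⟨f₁ * d₀, by rw [hy11f, hy10, smul_smul]⟩).elim
  · -- 15  Y Y Y X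
    exact (killY ⟨d₀, hy10⟩ ⟨f₀, hy01f⟩ ⟨d₁ * f₀, by rw [hy11d, hy01f, smul_smul]⟩).elim
  · -- 16  Y Y Y Y
    exact (killY ⟨d₀, hy10⟩ ⟨f₀, hy01f⟩ ⟨f₁ * d₀, by rw [hy11f, hy10, smul_smul]⟩).elim

end Summit.MatrixMultiplication.MatrixMultiplication.Theorems.OutsiderSandwichSegreLemmas
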